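import Summits.QuantumAdvantage.QuantumAdvantage.Theorems.CubicForrelationNearExactIsExactTwelveTypeOShape2932

/-!
# Crux `CubicForrelation.NearExactIsExact` (stmt-QuantumAdvantage-14043) — n = 12, type O with base set `960` in the OPEN window
  `29/32 < Φ < 929/1024`: DEAD (excess `< 512`, so `Σ v² ≤ 31`; the wild-function engine runs up to `Σ v² ≤ 31`)

Certificate seat `b2b-cforr-cert` (gen 22).  HONEST FRAMING: a kernel-checked lemma (standard axioms, no `decide`) about cubic Boolean pairs on
12 bits — one configuration of the window `(29/32, 929/1024)` on the `n = 12` ladder (HOME/b2b-cforr-cert-g20/PLAN-N12-928.md).  NO new value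
of `θ₁₂` by itself.  NOT summit progress.

* `to22_wild_engine31`: gen 20's `to20_wild_engine` with `Σ v² ≤ 31` instead of `≤ 24` and the level-5 hyperplane count of the partner taken as a
  HYPOTHESIS (`2048 ≤ #{u_f/2 odd}` whenever `u_f` is even with `u_f/2` odd somewhere) so that the engine is independent of `Φ`: `v̂ = 8k`,
  `4 ∣ k + u_f`; `|v̂| ≤ Σ|v| ≤ 31 < 32` gives `|k| ≤ 3`; `u_f` odd ⇒ `Σ k² ≥ 4096 > 64·31`; `u_f/2` odd on `≥ 2048` points ⇒ `Σ k² ≥ 4·2048`;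
  so `4 ∣ u_f`, `4 ∣ k`, `k ≡ 0`, `v ≡ 0`.
* `to22_typeO_E960_lt929_false`: cubic `f, g`, `W_g = 16u`, some `u` odd, `#E = 960`, `29/32 < Φ(f,g) < 929/1024` is impossible: the excess
  `X = 2¹⁷(1 − Φ) − 11776 < 512` gives `Σ v² ≤ 31`; partner identity + `to18_char_sum_E960` give `v̂ = 8k`, `4 ∣ k + u_f`; the hyperplane
  count comes from `tw20_hyperplane_gt2932`; the engine gives `v ≡ 0`, `Φ = 932/1024` — contradiction.
* `to22_typeO_E960_gt2932_false`: the same for every `Φ > 29/32` (at `Φ ≥ 929/1024` by `to20_typeO_E960_ge929_false`).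
The boundary value `Φ = 29/32` (`X = 512`, `Σ v² ≤ 32`: thirty-two aligned wild points would survive) is NOT treated here.

References: Kasami–Tokura (1970); MacWilliams–Sloane (1977) Ch. 14–15; Carlet (2021) §5.2; O'Donnell (2014) §1.4, §3.3.  Axioms: the standard three.
-/

set_option linter.dupNamespace false -- D-0017: single-problem summit ⇒ `QuantumAdvantage.QuantumAdvantage` by design

noncomputable section

namespace Summit.QuantumAdvantage.QuantumAdvantage.Theorems.CubicForrelation.NearExactIsExact

open Finset
open Literature.Computability.QuantumComplexity
open Literature.Computability.QuantumComplexity.BuzetChailloux (bxor zeroVec bxor_bxor_cancel_left bxor_zeroVec zeroVec_bxor bxor_comm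
  bxor_self twist_zeroVec_right twist_bxor_right)
open Literature.Computability.QuantumComplexity.DerivativeWalsh (W sum_W_sq)
open Literature.Computability.QuantumComplexity.Simon (twist_eq_one_or)
open Summit.QuantumAdvantage.QuantumAdvantage.Theorems.NearExactIsExact.Negative (TypeOTwelve.typeO_of_exists_odd)

/-! ### The wild-function engine up to `Σ v² ≤ 31`, `Φ`-free form -/

/-- **Wild-function engine, `Σ v² ≤ 31`.**  `f` cubic on 12 bits with `W_f = 16·u_f`; the level-5 hyperplane count of `f` as a hypothesis
(`u_f` even everywhere and `u_f/2` odd somewhere ⇒ at least `2048` points with `u_f/2` odd); an integer function `v` with `Σ v² ≤ 31` whose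
transform satisfies `v̂(y) = 8k(y)` with `4 ∣ k(y) + u_f(y)` for every `y`: then `v ≡ 0`.  See the module docstring. [this work] -/
theorem to22_wild_engine31 (f : (Fin (6 + 6) → Bool) → Bool) (hf : IsDegLeFun 3 f)
    (uf : (Fin (6 + 6) → Bool) → ℤ) (huf : ∀ y, W (fun x => signOf (f x)) y = (2 : ℝ) ^ 4 * (uf y : ℝ))
    (hS : (∀ y, ¬ Odd (uf y)) → (∃ y, Odd (uf y / 2)) → 2048 ≤ #(univ.filter fun y : Fin (6 + 6) → Bool => Odd (uf y / 2)))
    (v : (Fin (6 + 6) → Bool) → ℤ) (hV : ∑ x, v x ^ 2 ≤ 31)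
    (k : (Fin (6 + 6) → Bool) → ℤ) (hk : ∀ y, ∑ x, (v x : ℝ) * twist x y = 8 * (k y : ℝ)) (hk4 : ∀ y, (4 : ℤ) ∣ k y + uf y) :
    ∀ x, v x = 0 := by
  classical
  -- Parseval for `v`
  have hpars : ∑ y, (∑ x, (v x : ℝ) * twist x y) ^ 2 = 4096 * ∑ x, ((v x : ℝ)) ^ 2 := by
    have h := sum_W_sq (n := 6 + 6) (fun x => (v x : ℝ))
    unfold W at h
    rw [h]; norm_num
  have hV' : ∑ x, ((v x : ℝ)) ^ 2 ≤ 31 := by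
    have : ((∑ x, v x ^ 2 : ℤ) : ℝ) ≤ 31 := by exact_mod_cast hV
    push_cast at this; exact this
  have hk2sum : ∑ y, ((k y : ℝ)) ^ 2 ≤ 1984 := by
    have e : ∑ y, (∑ x, (v x : ℝ) * twist x y) ^ 2 = 64 * ∑ y, ((k y : ℝ)) ^ 2 := by
      rw [mul_sum]; exact sum_congr rfl fun y _ => by rw [hk y]; ring
    rw [e] at hpars
    nlinarith
  -- `|v̂| ≤ Σ|v| ≤ Σ v² ≤ 31 < 32`, so `|k| ≤ 3`
  have hkabs : ∀ y, |k y| ≤ 3 := by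
    intro y
    have h1 : |∑ x, (v x : ℝ) * twist x y| ≤ 31 := by
      calc |∑ x, (v x : ℝ) * twist x y| ≤ ∑ x, |(v x : ℝ) * twist x y| := abs_sum_le_sum_abs _ _
        _ = ∑ x, |(v x : ℝ)| := sum_congr rfl fun x _ => by
            rw [abs_mul]; rcases twist_eq_one_or x y with h | h <;> rw [h] <;> simp
        _ ≤ ∑ x, ((v x : ℝ)) ^ 2 := sum_le_sum fun x _ => by
            rw [← Int.cast_abs]
            have habs : |v x| ≤ v x ^ 2 := by
              rcases le_or_gt 0 (v x) with h | h
              · rw [abs_of_nonneg h]; nlinarith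
              · rw [abs_of_neg h]; nlinarith
            exact_mod_cast habs
        _ ≤ 31 := hV'
    rw [hk y, abs_mul, abs_of_nonneg (by norm_num : (0:ℝ) ≤ 8)] at h1
    have h2 : ((8 * |k y| : ℤ) : ℝ) ≤ 31 := by push_cast; exact h1
    have h3 : (8 * |k y| : ℤ) ≤ 31 := by exact_mod_cast h2
    omega
  -- a set of `N` points with `k² ≥ c` costs `c·N ≤ 1984`
  have hbig : ∀ (S : Finset (Fin (6 + 6) → Bool)) (c : ℝ), 0 ≤ c → (∀ y ∈ S, c ≤ ((k y : ℝ)) ^ 2) → c * #S ≤ 1984 := by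
    intro S c hc hS'
    have h1 : ∑ y ∈ S, c ≤ ∑ y ∈ S, ((k y : ℝ)) ^ 2 := sum_le_sum hS'
    rw [sum_const, nsmul_eq_mul, mul_comm] at h1
    have h2 : ∑ y ∈ S, ((k y : ℝ)) ^ 2 ≤ ∑ y, ((k y : ℝ)) ^ 2 :=
      sum_le_sum_of_subset_of_nonneg (subset_univ S) fun y _ _ => sq_nonneg _
    linarith
  by_cases hO : ∃ y, Odd (uf y)
  · -- all `u_f` odd, so all `k` odd: `k² ≥ 1` at `4096` points
    exfalso
    obtain ⟨y₁, hy₁⟩ := hO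
    have hdeg := stub_walshTower stub_axParity (6 + 6) 4 0 f uf hf huf (by intro j hj hjn; omega)
    have hallodd : ∀ y, Odd (uf y) := by
      intro y
      have h := tc_const_of_deg_zero hdeg y y₁
      have h1 : decide (Odd (uf y₁)) = true := by simpa using hy₁
      rw [h1] at h
      simpa using h
    have hk1 : ∀ y ∈ (univ : Finset (Fin (6 + 6) → Bool)), (1 : ℝ) ≤ ((k y : ℝ)) ^ 2 := by
      intro y _
      obtain ⟨j, hj⟩ := hk4 y
      have h0 := Int.odd_iff.1 (hallodd y)
      have : k y ≤ -1 ∨ 1 ≤ k y := by omega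
      have hsq := tp_sq_ge (k := 1) (by norm_num) this
      exact_mod_cast hsq
    have := hbig univ 1 (by norm_num) hk1
    rw [card_univ, Fintype.card_fun, Fintype.card_bool, Fintype.card_fin] at this
    norm_num at this
  · push Not at hO
    have hev2 : ∀ y, uf y = 2 * (uf y / 2) := fun y =>
      (Int.mul_ediv_cancel' (even_iff_two_dvd.1 (Int.not_odd_iff_even.1 (hO y)))).symm
    by_cases hO5 : ∃ y, Odd (uf y / 2)
    · -- the odd set of `u_f/2` has `≥ 2048` points and carries `k = ±2`
      exfalso
      have hcard := hS hO hO5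
      have h4 : ∀ y ∈ univ.filter (fun y : Fin (6 + 6) → Bool => Odd (uf y / 2)), (4 : ℝ) ≤ ((k y : ℝ)) ^ 2 := by
        intro y hy
        have hyo : Odd (uf y / 2) := (mem_filter.1 hy).2
        obtain ⟨j, hj⟩ := hk4 y
        have h0 := Int.odd_iff.1 hyo
        have h2 := hev2 y
        have : k y ≤ -2 ∨ 2 ≤ k y := by omega
        have hsq := tp_sq_ge (k := 2) (by norm_num) this
        have : (4 : ℤ) ≤ k y ^ 2 := by linarith
        exact_mod_cast this
      have h := hbig _ 4 (by norm_num) h4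
      have hc : (2048 : ℝ) ≤ (#(univ.filter fun y : Fin (6 + 6) → Bool => Odd (uf y / 2)) : ℝ) := by exact_mod_cast hcard
      linarith
    · push Not at hO5
      -- `4 ∣ u_f`, so `4 ∣ k`, `|k| ≤ 3`: `k ≡ 0`, `v̂ ≡ 0`, `v ≡ 0`
      have hk0 : ∀ y, k y = 0 := by
        intro y
        obtain ⟨j, hj⟩ := hk4 y
        have h2 := hev2 y
        have h4 : uf y / 2 = 2 * (uf y / 2 / 2) :=
          (Int.mul_ediv_cancel' (even_iff_two_dvd.1 (Int.not_odd_iff_even.1 (hO5 y)))).symm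
        have hk3 := hkabs y
        rw [abs_le] at hk3
        omega
      have hvhat0 : ∑ y, (∑ x, (v x : ℝ) * twist x y) ^ 2 = 0 :=
        sum_eq_zero fun y _ => by rw [hk y, hk0 y]; norm_num
      rw [hpars] at hvhat0
      have hsum0 : ∑ x, ((v x : ℝ)) ^ 2 = 0 := by linarith
      intro x
      have := (sum_eq_zero_iff_of_nonneg fun z _ => sq_nonneg ((v z : ℝ))).1 hsum0 x (mem_univ x)
      exact_mod_cast pow_eq_zero_iff two_ne_zero |>.1 this

/-! ### Base set `960` in the open window `29/32 < Φ < 929/1024` -/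

/-- **No type-O side with base set `960` at `29/32 < Φ < 929/1024`** (12 bits).  See the module docstring.  Finite-slice statement, NOT summit
progress. [this work] -/
theorem to22_typeO_E960_lt929_false (f g : (Fin (6 + 6) → Bool) → Bool) (hf : IsDegLeFun 3 f) (hg : IsDegLeFun 3 g)
    (u : (Fin (6 + 6) → Bool) → ℤ) (hu : ∀ x, W (fun y => signOf (g y)) x = (2 : ℝ) ^ 4 * (u x : ℝ))
    (hodd : ∃ x, Odd (u x)) (hE : #(univ.filter fun x : Fin (6 + 6) → Bool => (Odd (u x / 2) ↔ Odd (u x / 2 / 2))) = 960)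
    (hΦ : (29 / 32 : ℝ) < forrelation f g) (hhi : forrelation f g < 929 / 1024) : False := by
  classical
  have hΦ' : forrelation g f = forrelation f g := by
    rw [Summit.QuantumAdvantage.QuantumAdvantage.Theorems.SignedCubicForrelationNotPrBPP.Negative.HalfQuad.forrelation_comm]
  have hall : ∀ x, Odd (u x) := TypeOTwelve.typeO_of_exists_odd g u hg hu hodd
  have hu' : ∀ x, W (fun y => signOf (g y)) x = (2 : ℝ) ^ (2 * 2) * (u x : ℝ) := fun x => (hu x).trans (by norm_num)
  have hd1 : IsDegLeFun 1 (fun x => decide (Odd (u x / 2))) := z2_digitOne 2 g u hg hu' hall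
  have hd2 : IsDegLeFun 3 (fun x => decide (Odd (u x / 2 / 2))) := z2_digitTwo 2 g u hg hu' hall
  obtain ⟨c₁, b₁, hcb⟩ := stub_affineForm (6 + 6) _ hd1
  set E := univ.filter (fun x : Fin (6 + 6) → Bool => (Odd (u x / 2) ↔ Odd (u x / 2 / 2))) with hEdef
  have hdegE : IsDegLeFun (2 + 1) (fun x => (decide (Odd (u x / 2)) ^^ decide (Odd (u x / 2 / 2))) ^^ true) :=
    tb_isDegLeFun_xor_const (bb_isDegLeFun_bxor (hd1.mono (by norm_num)) hd2) true
  have hsetE : (univ.filter fun x : Fin (6 + 6) → Bool =>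
      ((decide (Odd (u x / 2)) ^^ decide (Odd (u x / 2 / 2))) ^^ true) = true) = E := by
    rw [hEdef]
    apply filter_congr
    intro x _
    by_cases h1 : Odd (u x / 2) <;> by_cases h2 : Odd (u x / 2 / 2) <;> simp [h1, h2]
  -- budget: `Σ τ² = 2¹⁷(1 − Φ) < 12288`
  obtain ⟨-, -, hbud⟩ := to19_typeO_gt2932_shape f g hf hg u hu hodd hΦ
  have hT : (∑ x, (u x - 4 * sZ (f x)) ^ 2 : ℤ) ≤ 12287 := by
    have h' : ((∑ x, (u x - 4 * sZ (f x)) ^ 2 : ℤ) : ℝ) < 12288 := by rw [hbud]; linarith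
    have h'' : (∑ x, (u x - 4 * sZ (f x)) ^ 2 : ℤ) < 12288 := by exact_mod_cast h'
    omega
  -- wild decomposition `τ = τ₀ + 8v`
  choose v hv using fun x => to12_pt_mod8 (u x) (sZ (f x)) (hall x) (tp_sZ_cases (f x))
  set τ₀ : (Fin (6 + 6) → Bool) → ℤ := fun x =>
    sZ (decide (Odd (u x / 2))) * (1 - 4 * (if (Odd (u x / 2) ↔ Odd (u x / 2 / 2)) then 1 else 0)) with hτ₀def
  have hτ₀val : ∀ x, τ₀ x = 1 ∨ τ₀ x = -1 ∨ τ₀ x = 3 ∨ τ₀ x = -3 := by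
    intro x
    simp only [τ₀]
    rcases tp_sZ_cases (decide (Odd (u x / 2))) with h | h <;> rw [h] <;> split_ifs <;> norm_num
  have hτ₀sq : ∀ x, τ₀ x ^ 2 = 1 + 8 * (if (Odd (u x / 2) ↔ Odd (u x / 2 / 2)) then 1 else 0 : ℤ) := by
    intro x
    simp only [τ₀]
    rcases tp_sZ_cases (decide (Odd (u x / 2))) with h | h <;> rw [h] <;> split_ifs <;> norm_num
  have hsumE : (∑ x, (if (Odd (u x / 2) ↔ Odd (u x / 2 / 2)) then 1 else 0 : ℤ)) = #E := by rw [sum_boole]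
  have hsumτ₀ : ∑ x, τ₀ x ^ 2 = 11776 := by
    rw [sum_congr rfl fun x _ => hτ₀sq x, sum_add_distrib, ← mul_sum, hsumE, sum_const, card_univ, Fintype.card_fun,
      Fintype.card_bool, Fintype.card_fin, hE]
    norm_num
  have hX16 : ∀ x, 16 * v x ^ 2 ≤ (τ₀ x + 8 * v x) ^ 2 - τ₀ x ^ 2 := by
    intro x
    have ht : -3 ≤ τ₀ x ∧ τ₀ x ≤ 3 := by rcases hτ₀val x with h | h | h | h <;> rw [h] <;> norm_num
    have key : 0 ≤ v x * (3 * v x + τ₀ x) := by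
      rcases lt_trichotomy (v x) 0 with hlt | heq | hgt
      · have h1 : 3 * v x + τ₀ x ≤ 0 := by linarith
        nlinarith
      · rw [heq]; simp
      · have h1 : 0 ≤ 3 * v x + τ₀ x := by linarith
        exact mul_nonneg hgt.le h1
    nlinarith [key]
  have hV : ∑ x, v x ^ 2 ≤ 31 := by
    have hTdec : (∑ x, (u x - 4 * sZ (f x)) ^ 2 : ℤ) = ∑ x, τ₀ x ^ 2 + ∑ x, ((τ₀ x + 8 * v x) ^ 2 - τ₀ x ^ 2) := by
      rw [← sum_add_distrib]; exact sum_congr rfl fun x _ => by rw [hv x]; ring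
    have h1 : 16 * ∑ x, v x ^ 2 ≤ ∑ x, ((τ₀ x + 8 * v x) ^ 2 - τ₀ x ^ 2) := by
      rw [mul_sum]; exact sum_le_sum fun x _ => hX16 x
    have h2 : 16 * ∑ x, v x ^ 2 ≤ 511 := by linarith
    omega
  -- the partner and the wild identity
  obtain ⟨uf, huf⟩ := tw_base (n := 6 + 6) f hf 4 (by norm_num)
  have hid : ∀ y, 64 * (uf y : ℝ) = 256 * signOf (g y) -
      signOf b₁ * ((if bxor c₁ y = (fun _ => false) then (2 : ℝ) ^ (6 + 6) else 0) - 4 * ∑ x ∈ E, twist x (bxor c₁ y)) -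
      8 * ∑ x, (v x : ℝ) * twist x y := by
    intro y
    have h := to18_typeO_partner_identity f g u hu v hv c₁ b₁ hcb uf huf y
    rw [← hEdef] at h
    exact h
  have hsb : ((sZ b₁ : ℤ) : ℝ) = signOf b₁ := tp_sZ_cast _
  -- `v̂ = 8k` with `4 ∣ k + u_f`
  have hk : ∀ y, ∃ k : ℤ, (∑ x, (v x : ℝ) * twist x y) = 8 * (k : ℝ) ∧ (4 : ℤ) ∣ k + uf y := by
    intro y
    obtain ⟨m', -, hm'⟩ := to18_char_sum_E960 _ hdegE (by rw [hsetE]; exact hE) (bxor c₁ y)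
    rw [hsetE] at hm'
    have h := hid y
    rw [hm'] at h
    by_cases hz : bxor c₁ y = (fun _ => false)
    · rw [if_pos hz] at h
      refine ⟨4 * sZ (g y) - 64 * sZ b₁ + 4 * sZ b₁ * m' - uf y, ?_, ⟨sZ (g y) - 16 * sZ b₁ + sZ b₁ * m', by ring⟩⟩
      push_cast; rw [tp_sZ_cast, hsb]
      have e4096 : (2 : ℝ) ^ (6 + 6) = 4096 := by norm_num
      rw [e4096] at h
      linarith
    · rw [if_neg hz] at h
      refine ⟨4 * sZ (g y) + 4 * sZ b₁ * m' - uf y, ?_, ⟨sZ (g y) + sZ b₁ * m', by ring⟩⟩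
      push_cast; rw [tp_sZ_cast, hsb]
      linarith
  choose k hk8 hk4 using hk
  -- the hyperplane count of the partner at `Φ > 29/32`
  have hS : (∀ y, ¬ Odd (uf y)) → (∃ y, Odd (uf y / 2)) → 2048 ≤ #(univ.filter fun y : Fin (6 + 6) → Bool => Odd (uf y / 2)) := by
    intro hO hO5
    have huf5 := tw_level_up (j := 4) f uf huf hO
    obtain ⟨γ', t', ht', hγ'0, hPf⟩ := tw20_hyperplane_gt2932 g f hf (fun y => uf y / 2) huf5 hO5 (by rw [hΦ']; exact hΦ)
    have hcard := tw59_card_half γ' hγ'0 t' ht'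
    have e1 : (univ.filter fun y : Fin (6 + 6) → Bool => Odd (uf y / 2)) = univ.filter (fun y : Fin (6 + 6) → Bool => twist γ' y = t') :=
      filter_congr fun y _ => hPf y
    rw [e1, hcard]
  have hv0 := to22_wild_engine31 f hf uf huf hS v hV k hk8 hk4
  -- so the excess vanishes and `Φ = 932/1024`
  have hTeq : (∑ x, (u x - 4 * sZ (f x)) ^ 2 : ℤ) = 11776 := by
    rw [← hsumτ₀]; exact sum_congr rfl fun x _ => by rw [hv x, hv0 x]; ring
  have h : ((∑ x, (u x - 4 * sZ (f x)) ^ 2 : ℤ) : ℝ) = 11776 := by exact_mod_cast hTeq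
  rw [hbud] at h
  linarith

/-- **No type-O side with base set `960` anywhere in the open window `Φ > 29/32`** (12 bits): at `Φ ≥ 929/1024` by
`to20_typeO_E960_ge929_false`, below by `to22_typeO_E960_lt929_false`.  NOT summit progress. [this work] -/
theorem to22_typeO_E960_gt2932_false (f g : (Fin (6 + 6) → Bool) → Bool) (hf : IsDegLeFun 3 f) (hg : IsDegLeFun 3 g)
    (u : (Fin (6 + 6) → Bool) → ℤ) (hu : ∀ x, W (fun y => signOf (g y)) x = (2 : ℝ) ^ 4 * (u x : ℝ))
    (hodd : ∃ x, Odd (u x)) (hE : #(univ.filter fun x : Fin (6 + 6) → Bool => (Odd (u x / 2) ↔ Odd (u x / 2 / 2))) = 960)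
    (hΦ : (29 / 32 : ℝ) < forrelation f g) : False := by
  by_cases h929 : (929 / 1024 : ℝ) ≤ forrelation f g
  · exact to20_typeO_E960_ge929_false f g hf hg u hu hodd hE h929
  · push Not at h929
    exact to22_typeO_E960_lt929_false f g hf hg u hu hodd hE hΦ h929

end Summit.QuantumAdvantage.QuantumAdvantage.Theorems.CubicForrelation.NearExactIsExact

end
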